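import Summits.HodgeConjecture.CorCM.MultiFieldWeilQuarticSlotMovers
import HarnessLib

/-!
# MULTI-FIELD WEIL ENGINE — MOVERS OUT OF AN IMPRIMITIVE QUARTIC SLOT FOR FREE: a slot whose image preserves a pairing of its four letters is a `2`-group, so the fourth
# power of a tuple with a component of order `3` elsewhere is trivial on it and not elsewhere; stabiliser-transitivity OUT OF an octic field with an intermediate
# quartic CM field into every sextic slot and every `2`-transitive octic slot, with no hypothesis relating the fields

Cell `pub-hodgecm2` (COR-CM), seat b30 gen 41 (2026-08-26); count-neutral own lane MULTI-FIELD WEIL ENGINE (stem `MultiFieldWeil*`), census + realised reading, the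
companion of the cross-degree decoupling (`CorCM/MultiFieldWeilDecoupling.lean` D1, `CorCM/MultiFieldWeilRankedTransfer.lean` D2) on the OTHER side of the flag: in the
NET THEOREM (`CorCM/MultiFieldWeilNetTheoremFree.lean`) the only hypotheses left OUT OF an unflagged octic field `K` are «a value of the sextic ∕ flagged-octic field
outside `L(K)`» (`hout4`); here they are DISCHARGED when the unflaggedness is CERTIFIED by an intermediate field `k ⊂ F ⊂ K`, `[K : F] = 2` (quartic part `C₄`, `V₄`
or `D₄`).  Theorems only; no definition, no named fact, no `sorry`, no `decide`.  HONEST FRAMING: group theory and field counting; `HC_CM` is NOT touched.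

* §1 (census) **`pow_four_eq_one_of_blocks`**: a permutation `σ` of `k` letters compatible with a map `β` (`β(σ x) = β(σ x') ↔ β x = β x'`) whose image has `≤ 2` values
  and whose fibres have `≤ 2` elements satisfies `σ⁴ = 1` (`σ²` fixes the `β`-value, then acts on a fibre of size `≤ 2`).  **`exists_mover_of_pow_four`**: if every
  tuple of `R` has `π_{m₀}⁴ = 1` and some `g ∈ R` has `g_m` of order `3`, then `ν = g⁴ ∈ R` is trivial at `m₀` and moves a letter of `m` (`ν_m = g_m`).  Elements of
  order `3`: **`exists_orderOf_eq_three_of_transitive`** (a slot with three letters, `R` transitive: `3 ∣ |image|`, Cauchy), **`…_of_twoTransitive_four`** (four letters,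
  `2`-transitive: `12 ∣ |image|`).  Hence **`stabTransitive_of_blocks_into_three`** (W1 `stabTransitive_of_mover_prime`) and **`stabTransitive_of_blocks_into_four`**
  (V1 `stabTransitive_of_mover_twoTransitive`): the tuples of `R` trivial at the block slot `m₀` are TRANSITIVE on every slot of size `3` and on every `2`-transitive slot
  of size `4` — NO hypothesis relating the slots.
* §2 (realised) **`card_filter_comp_eq_of_finrank_tower`** (`[K : F] = q` extensions of each `φ : F → ℂ`), **`pow_four_eq_one_realisedTuples_of_intermediate`**: for an
  octic slot `K_{m₀} ⊇ j(F) ⊇ i(k)` with `[F : ℚ] = 4`, every realised tuple has `π_{m₀}⁴ = 1` (restriction to `F` is a block map with two values and fibres of size two);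
  **`stabTransitive_realisedTuples_of_intermediate_into_three ∕ …_into_four`**: the realised tuples trivial at `m₀` are transitive on every sextic slot and on every
  octic slot with a degree-`24` pair.  USE (sequel): in the NET THEOREM an octic field CERTIFIED imprimitive by an intermediate quartic CM field needs NO hypothesis
  towards sextic, primitive-octic and decic fields — only linear disjointness from the OTHER imprimitive octic fields.
[cite: DixonMortimer1996, §1.5 (blocks), §1.6, Thm. 1.6A; §2.1] [cite: Wielandt1964, §9–§10] [cite: Lang2002, I §6 (Cauchy), VI §1 Thm. 1.1 and Cor. 1.6; V §1 Prop. 1.2]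
[cite: Shimura1998, §18.2 Lemma (i)]

## References
* [DixonMortimer1996] J. D. Dixon, B. Mortimer, *Permutation Groups*, GTM 163, §1.5–§1.6, §2.1.  [Wielandt1964] H. Wielandt, *Finite Permutation Groups*, §9–§10.
  [Lang2002] S. Lang, *Algebra*, GTM 211, I §6, V §1, VI §1.  [Shimura1998] G. Shimura, *Abelian varieties with complex multiplication and modular functions*, §18.2.
-/

noncomputable section

open NumberField

namespace Summit.HodgeConjecture.CorCM.MultiFieldWeil

open Finset
open Summit.HodgeConjecture.CorCM.Census.MultiFieldWeil

open scoped Classical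

/-! ## §1 Census: a block-preserving permutation with two blocks of size two has order dividing four; movers from an element of order three -/

section Blocks

/-- **`σ⁴ = 1` FOR A PERMUTATION PRESERVING A PAIRING**: `σ` compatible with `β` (`β(σ x) = β(σ x') ↔ β x = β x'`), `β` with at most two values and fibres of size at
most two. [cite: DixonMortimer1996, §1.5] -/
theorem pow_four_eq_one_of_blocks {k : ℕ} {Y : Type} (β : Fin k → Y) (σ : Equiv.Perm (Fin k)) (hσ : ∀ x x', β (σ x) = β (σ x') ↔ β x = β x')
    (himg : (Finset.univ.image β).card ≤ 2) (hfib : ∀ x, (Finset.univ.filter fun x' => β x' = β x).card ≤ 2) : σ ^ 4 = 1 := by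
  have h2 : ∀ x, (σ ^ 2) x = σ (σ x) := fun x => by rw [sq, Equiv.Perm.mul_apply]
  -- `σ²` preserves the `β`-value
  have hA : ∀ x, β ((σ ^ 2) x) = β x := by
    intro x
    rw [h2]
    by_cases h : β (σ x) = β x
    · exact ((hσ (σ x) x).2 h).trans h
    · have hne : β (σ (σ x)) ≠ β (σ x) := fun h' => h ((hσ (σ x) x).1 h')
      by_contra hx
      have hsub : ({β x, β (σ x), β (σ (σ x))} : Finset Y) ⊆ Finset.univ.image β := fun y hy => by
        simp only [Finset.mem_insert, Finset.mem_singleton] at hy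
        rcases hy with rfl | rfl | rfl <;> exact Finset.mem_image_of_mem β (Finset.mem_univ _)
      have h3 : ({β x, β (σ x), β (σ (σ x))} : Finset Y).card = 3 :=
        Finset.card_eq_three.2 ⟨β x, β (σ x), β (σ (σ x)), Ne.symm h, Ne.symm hx, hne.symm, rfl⟩
      have := Finset.card_le_card hsub
      omega
  -- `σ⁴` fixes every letter: `x`, `σ² x`, `σ⁴ x` lie in one fibre
  have h4 : σ ^ 4 = σ ^ 2 * σ ^ 2 := by rw [← pow_add]
  refine Equiv.ext fun x => ?_
  rw [h4, Equiv.Perm.mul_apply, Equiv.Perm.one_apply]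
  by_cases hy : (σ ^ 2) x = x
  · rw [hy, hy]
  · have hmem : ∀ z, β z = β x → z ∈ Finset.univ.filter fun x' => β x' = β x := fun z hz => Finset.mem_filter.2 ⟨Finset.mem_univ z, hz⟩
    have hz : β ((σ ^ 2) ((σ ^ 2) x)) = β x := (hA _).trans (hA x)
    by_contra hne
    by_cases hzy : (σ ^ 2) ((σ ^ 2) x) = (σ ^ 2) x
    · exact hy ((σ ^ 2).injective hzy)
    · have hsub : ({x, (σ ^ 2) x, (σ ^ 2) ((σ ^ 2) x)} : Finset (Fin k)) ⊆ Finset.univ.filter fun x' => β x' = β x := fun z hz' => by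
        simp only [Finset.mem_insert, Finset.mem_singleton] at hz'
        rcases hz' with rfl | rfl | rfl
        exacts [hmem _ rfl, hmem _ (hA x), hmem _ hz]
      have h3 : ({x, (σ ^ 2) x, (σ ^ 2) ((σ ^ 2) x)} : Finset (Fin k)).card = 3 :=
        Finset.card_eq_three.2 ⟨x, (σ ^ 2) x, (σ ^ 2) ((σ ^ 2) x), Ne.symm hy, fun h => hne h.symm, Ne.symm hzy, rfl⟩
      have := Finset.card_le_card hsub
      have := hfib x
      omega

variable {r : ℕ} {n : Fin r → ℕ} {R : Finset (PermsG n)}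

/-- A set of tuples closed under products is closed under positive powers. [folklore] -/
theorem pow_succ_mem_of_closed (hmul : ∀ π ∈ R, ∀ π' ∈ R, π * π' ∈ R) {π : PermsG n} (hπ : π ∈ R) (j : ℕ) : π ^ (j + 1) ∈ R := by
  induction j with
  | zero => rw [zero_add, pow_one]; exact hπ
  | succ j ih => rw [pow_succ]; exact hmul _ ih _ hπ

/-- **A MOVER OUT OF A `2`-GROUP SLOT FROM AN ELEMENT OF ORDER `3`**: if every tuple of `R` has `π_{m₀}⁴ = 1` and `g ∈ R` has `g_m` of order `3`, then `g⁴ ∈ R` is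
trivial at `m₀` and moves a letter of `m`. [cite: Lang2002, I §6] -/
theorem exists_mover_of_pow_four (hmul : ∀ π ∈ R, ∀ π' ∈ R, π * π' ∈ R) {m₀ m : Fin r} (h4 : ∀ π ∈ R, (π m₀) ^ 4 = 1) {g : PermsG n} (hg : g ∈ R)
    (hord : orderOf (g m) = 3) : ∃ a : Fin (n m), ∃ ν ∈ R, ν m₀ = 1 ∧ ν m a ≠ a := by
  have hgm : (g ^ 4) m = g m := by
    rw [Pi.pow_apply, show (4 : ℕ) = 3 + 1 from rfl, pow_succ, ← hord, pow_orderOf_eq_one, one_mul]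
  have hne : g m ≠ 1 := fun h => by rw [h, orderOf_one] at hord; exact absurd hord (by norm_num)
  obtain ⟨a, ha⟩ : ∃ a, g m a ≠ a := by
    by_contra hno
    push Not at hno
    exact hne (Equiv.ext hno)
  exact ⟨a, g ^ 4, pow_succ_mem_of_closed hmul hg 3, by rw [Pi.pow_apply]; exact h4 g hg, by rw [hgm]; exact ha⟩

/-- **A TRANSITIVE SLOT WITH THREE LETTERS CARRIES AN ELEMENT OF ORDER `3`** (`3 ∣ |image|`, Cauchy). [cite: DixonMortimer1996, §1.6, Thm. 1.6A] [cite: Lang2002, I §6] -/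
theorem exists_orderOf_eq_three_of_transitive (hmul : ∀ π ∈ R, ∀ π' ∈ R, π * π' ∈ R) (hinv : ∀ π ∈ R, π⁻¹ ∈ R) (hne : R.Nonempty) {m : Fin r}
    (h3 : n m = 3) (htr : ∀ a a' : Fin (n m), ∃ π ∈ R, π m a = a') : ∃ g ∈ R, orderOf (g m) = 3 := by
  let Gs : Subgroup (PermsG n) :=
    { carrier := ↑R
      mul_mem' := fun {π π'} hπ hπ' => hmul π hπ π' hπ'
      one_mem' := one_mem_of_closed hmul hinv hne
      inv_mem' := fun {π} hπ => hinv π hπ }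
  let φ : ↥Gs →* Equiv.Perm (Fin (n m)) := (Pi.evalMonoidHom (fun l : Fin r => Equiv.Perm (Fin (n l))) m).comp Gs.subtype
  have hφ : ∀ g : ↥Gs, φ g = (g : PermsG n) m := fun _ => rfl
  haveI : Nonempty (Fin (n m)) := ⟨⟨0, by omega⟩⟩
  have hdvd : 3 ∣ Nat.card φ.range := by
    rw [← Subgroup.index_ker]
    have h := card_dvd_index_ker_of_transitive φ fun x y => by
      obtain ⟨π, hπ, hπx⟩ := htr x y
      exact ⟨⟨π, hπ⟩, by rw [hφ]; exact hπx⟩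
    have hc : Nat.card (Fin (n m)) = 3 := by rw [Nat.card_eq_fintype_card, Fintype.card_fin, h3]
    rwa [hc] at h
  haveI : Fact (Nat.Prime 3) := ⟨Nat.prime_three⟩
  obtain ⟨x, hx⟩ := exists_prime_orderOf_dvd_card' 3 hdvd
  obtain ⟨g, hg⟩ := x.2
  refine ⟨(g : PermsG n), g.2, ?_⟩
  rw [← hφ, hg, Subgroup.orderOf_coe, hx]

/-- **A `2`-TRANSITIVE SLOT WITH FOUR LETTERS CARRIES AN ELEMENT OF ORDER `3`** (`12 ∣ |image|`, Cauchy). [cite: Wielandt1964, §9] [cite: Lang2002, I §6] -/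
theorem exists_orderOf_eq_three_of_twoTransitive_four (hmul : ∀ π ∈ R, ∀ π' ∈ R, π * π' ∈ R) (hinv : ∀ π ∈ R, π⁻¹ ∈ R) (hne : R.Nonempty) {m : Fin r}
    (h4 : n m = 4) (h2t : ∀ a b a' b' : Fin (n m), a ≠ b → a' ≠ b' → ∃ π ∈ R, π m a = a' ∧ π m b = b') : ∃ g ∈ R, orderOf (g m) = 3 := by
  let Gs : Subgroup (PermsG n) :=
    { carrier := ↑R
      mul_mem' := fun {π π'} hπ hπ' => hmul π hπ π' hπ'
      one_mem' := one_mem_of_closed hmul hinv hne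
      inv_mem' := fun {π} hπ => hinv π hπ }
  let φ : ↥Gs →* Equiv.Perm (Fin (n m)) := (Pi.evalMonoidHom (fun l : Fin r => Equiv.Perm (Fin (n l))) m).comp Gs.subtype
  have hφ : ∀ g : ↥Gs, φ g = (g : PermsG n) m := fun _ => rfl
  have hdvd : 3 ∣ Nat.card φ.range := by
    rw [← Subgroup.index_ker]
    have h := descFactorial_two_dvd_index_ker_of_twoTransitive (by rw [Fintype.card_fin]; omega) φ fun a b c d hab hcd => by
      obtain ⟨π, hπ, h₁, h₂⟩ := h2t a b c d hab hcd
      exact ⟨⟨π, hπ⟩, by rw [hφ]; exact h₁, by rw [hφ]; exact h₂⟩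
    have hc : (Fintype.card (Fin (n m))).descFactorial 2 = 12 := by rw [Fintype.card_fin, h4]; rfl
    rw [hc] at h
    exact (show (3 : ℕ) ∣ 12 by norm_num).trans h
  haveI : Fact (Nat.Prime 3) := ⟨Nat.prime_three⟩
  obtain ⟨x, hx⟩ := exists_prime_orderOf_dvd_card' 3 hdvd
  obtain ⟨g, hg⟩ := x.2
  refine ⟨(g : PermsG n), g.2, ?_⟩
  rw [← hφ, hg, Subgroup.orderOf_coe, hx]

/-- **OUT OF A `2`-GROUP SLOT INTO A SLOT WITH THREE LETTERS, STABILISER-TRANSITIVITY FOR FREE.** [cite: DixonMortimer1996, §1.6, Thm. 1.6A] [cite: Wielandt1964, §9–§10] -/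
theorem stabTransitive_of_blocks_into_three (hmul : ∀ π ∈ R, ∀ π' ∈ R, π * π' ∈ R) (hinv : ∀ π ∈ R, π⁻¹ ∈ R) (hne : R.Nonempty) {m₀ m : Fin r}
    (hblk : ∀ π ∈ R, (π m₀) ^ 4 = 1) (h3 : n m = 3) (htr : ∀ a a' : Fin (n m), ∃ π ∈ R, π m a = a') (a a' : Fin (n m)) :
    ∃ ν ∈ R, ν m₀ = 1 ∧ ν m a = a' := by
  obtain ⟨g, hg, hord⟩ := exists_orderOf_eq_three_of_transitive hmul hinv hne h3 htr
  exact stabTransitive_of_mover_prime hmul hinv hne (by rw [h3]; exact Nat.prime_three) htr (exists_mover_of_pow_four hmul hblk hg hord) a a'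

/-- **OUT OF A `2`-GROUP SLOT INTO A `2`-TRANSITIVE SLOT WITH FOUR LETTERS, STABILISER-TRANSITIVITY FOR FREE.** [cite: DixonMortimer1996, §1.6, Thm. 1.6A]
[cite: Wielandt1964, §9–§10] -/
theorem stabTransitive_of_blocks_into_four (hmul : ∀ π ∈ R, ∀ π' ∈ R, π * π' ∈ R) (hinv : ∀ π ∈ R, π⁻¹ ∈ R) (hne : R.Nonempty) {m₀ m : Fin r}
    (hblk : ∀ π ∈ R, (π m₀) ^ 4 = 1) (h4 : n m = 4) (h2t : ∀ a b a' b' : Fin (n m), a ≠ b → a' ≠ b' → ∃ π ∈ R, π m a = a' ∧ π m b = b')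
    (a a' : Fin (n m)) : ∃ ν ∈ R, ν m₀ = 1 ∧ ν m a = a' := by
  obtain ⟨g, hg, hord⟩ := exists_orderOf_eq_three_of_twoTransitive_four hmul hinv hne h4 h2t
  exact stabTransitive_of_mover_twoTransitive hmul hinv hne h2t (exists_mover_of_pow_four hmul hblk hg hord) a a'

end Blocks

/-! ## §2 Realised: an intermediate quartic CM field makes the octic slot a block slot -/

section Realised

/-- **Each embedding `φ : F → ℂ` has exactly `q` extensions to `K` along `j : F → K` when `[K : ℚ] = [F : ℚ]·q`** (the `F`-algebra maps `K →ₐ[F] ℂ`; Mathlib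
`AlgHom.card`, tower law). [cite: Lang2002, V §1 Prop. 1.2; VI §1 Thm. 1.1] -/
theorem card_filter_comp_eq_of_finrank_tower {K F : Type} [Field K] [NumberField K] [Field F] [NumberField F] {d q : ℕ} (j : F →+* K)
    (hF : Module.finrank ℚ F = d) (hK : Module.finrank ℚ K = d * q) (hd : 0 < d) (φ : F →+* ℂ) :
    (Finset.univ.filter fun s : K →+* ℂ => s.comp j = φ).card = q := by
  letI : Algebra F K := j.toAlgebra
  letI : Algebra F ℂ := φ.toAlgebra
  haveI : IsScalarTower ℚ F K := IsScalarTower.of_algebraMap_eq fun x => by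
    rw [RingHom.algebraMap_toAlgebra, eq_ratCast, eq_ratCast, map_ratCast]
  haveI : FiniteDimensional F K := FiniteDimensional.right ℚ F K
  have hFK : Module.finrank F K = q := by
    have h := Module.finrank_mul_finrank ℚ F K
    rw [hF, hK] at h
    exact Nat.eq_of_mul_eq_mul_left hd h
  have hcomm : ∀ f : K →ₐ[F] ℂ, f.toRingHom.comp j = φ := fun f => RingHom.ext fun x => f.commutes x
  have hcomm' : ∀ s : {s : K →+* ℂ // s.comp j = φ}, ∀ x : F, s.1.toFun (algebraMap F K x) = algebraMap F ℂ x :=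
    fun s x => RingHom.congr_fun s.2 x
  let eqv : (K →ₐ[F] ℂ) ≃ {s : K →+* ℂ // s.comp j = φ} :=
    { toFun := fun f => ⟨f.toRingHom, hcomm f⟩
      invFun := fun s => ⟨s.1, hcomm' s⟩
      left_inv := fun f => AlgHom.ext fun x => rfl
      right_inv := fun s => Subtype.ext (RingHom.ext fun x => rfl) }
  rw [← Fintype.card_subtype, ← Fintype.card_congr eqv, AlgHom.card, hFK]

variable {I : Type} {r : ℕ} {Kf : I → Type} [∀ i, Field (Kf i)] [∀ i, NumberField (Kf i)] {i₀ : I} {is : Fin r → I} {n : Fin r → ℕ}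
  {e : ∀ m : Fin r, (Kf (is m) →+* ℂ) ≃ Fin (n m) × Bool} {τ : Kf i₀ →+* ℂ} {im : ∀ m : Fin r, Kf i₀ →+* Kf (is m)}
  (he_sign : ∀ (m : Fin r) (s : Kf (is m) →+* ℂ), (e m s).2 = true ↔ s.comp (im m) = τ)

include he_sign in
/-- **AN INTERMEDIATE QUARTIC CM FIELD MAKES THE OCTIC SLOT A BLOCK SLOT**: `K_{m₀} ⊇ j(F) ⊇ j(i(k)) = im(k)`, `[F : ℚ] = 4`, `[K_{m₀} : ℚ] = 8`, `[k : ℚ] = 2`: every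
realised tuple has `π_{m₀}⁴ = 1` (restriction to `F` is a block map on the four `τ`-embeddings: two values, fibres of size two). [cite: Shimura1998, §18.2 Lemma (i)]
[cite: Lang2002, V §1 Prop. 1.2; VI §1 Thm. 1.1] [cite: DixonMortimer1996, §1.5] -/
theorem pow_four_eq_one_realisedTuples_of_intermediate (h2 : Module.finrank ℚ (Kf i₀) = 2) (m₀ : Fin r) (h8 : Module.finrank ℚ (Kf (is m₀)) = 8)
    {F : Type} [Field F] [NumberField F] (hF : Module.finrank ℚ F = 4) (iF : Kf i₀ →+* F) (jF : F →+* Kf (is m₀)) (hj : jF.comp iF = im m₀)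
    {π : PermsG n} (hπ : π ∈ realisedTuples e τ) : (π m₀) ^ 4 = 1 := by
  obtain ⟨ρ, -, hρ⟩ := (mem_realisedTuples e τ π).1 hπ
  -- the block map: restriction to `F`
  let β : Fin (n m₀) → (F →+* ℂ) := fun a => ((e m₀).symm (a, true)).comp jF
  have hs : ∀ a : Fin (n m₀), ((e m₀).symm (a, true)).comp (im m₀) = τ := fun a => (he_sign m₀ _).1 (by rw [Equiv.apply_symm_apply])
  have hβρ : ∀ a, β (π m₀ a) = (ρ : ℂ →+* ℂ).comp (β a) := fun a => by
    show ((e m₀).symm (π m₀ a, true)).comp jF = _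
    rw [← hρ m₀ a, RingHom.comp_assoc]
  refine pow_four_eq_one_of_blocks β (π m₀) (fun x x' => ?_) ?_ (fun x => ?_)
  · rw [hβρ, hβρ]
    constructor
    · intro h
      exact RingHom.ext fun y => ρ.injective (RingHom.congr_fun h y)
    · intro h; rw [h]
  · -- at most two values: the `τ`-embeddings of `F`
    have hsub : Finset.univ.image β ⊆ Finset.univ.filter fun φ : F →+* ℂ => φ.comp iF = τ := fun φ hφ => by
      obtain ⟨a, -, rfl⟩ := Finset.mem_image.1 hφ
      refine Finset.mem_filter.2 ⟨Finset.mem_univ _, ?_⟩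
      show (((e m₀).symm (a, true)).comp jF).comp iF = τ
      rw [RingHom.comp_assoc, hj]
      exact hs a
    have hc := SexticOcticWeil.card_filter_comp_eq_of_finrank (n := 2) iF (by rw [hF]) h2 τ
    exact (Finset.card_le_card hsub).trans hc.le
  · -- fibres of size two: the extensions of `β x` to `K`
    have hsub : (Finset.univ.filter fun x' => β x' = β x) ⊆ (Finset.univ.filter fun s : Kf (is m₀) →+* ℂ => s.comp jF = β x).image
        (fun s => (e m₀ s).1) := fun x' hx' => by
      refine Finset.mem_image.2 ⟨(e m₀).symm (x', true), Finset.mem_filter.2 ⟨Finset.mem_univ _, (Finset.mem_filter.1 hx').2⟩, ?_⟩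
      rw [Equiv.apply_symm_apply]
    have hc := card_filter_comp_eq_of_finrank_tower (d := 4) (q := 2) jF hF (by rw [h8]) (by norm_num) (β x)
    exact (Finset.card_le_card hsub).trans (Finset.card_image_le.trans hc.le)

include he_sign in
/-- **OUT OF AN OCTIC FIELD WITH AN INTERMEDIATE QUARTIC CM FIELD INTO A SEXTIC SLOT: STABILISER-TRANSITIVITY FOR FREE.** [cite: Shimura1998, §18.2 Lemma (i)]
[cite: DixonMortimer1996, §1.5, §1.6 Thm. 1.6A] [cite: Lang2002, I §6] -/
theorem stabTransitive_realisedTuples_of_intermediate_into_three (h2 : Module.finrank ℚ (Kf i₀) = 2) (m₀ m : Fin r) (h8 : Module.finrank ℚ (Kf (is m₀)) = 8)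
    {F : Type} [Field F] [NumberField F] (hF : Module.finrank ℚ F = 4) (iF : Kf i₀ →+* F) (jF : F →+* Kf (is m₀)) (hj : jF.comp iF = im m₀)
    (h3 : n m = 3) (a a' : Fin (n m)) : ∃ ν ∈ realisedTuples e τ, ν m₀ = 1 ∧ ν m a = a' :=
  stabTransitive_of_blocks_into_three (fun _ hπ _ hπ' => mul_mem_realisedTuples e τ hπ hπ') (fun _ hπ => inv_mem_realisedTuples hπ)
    (realisedTuples_nonempty (e := e) he_sign) (fun _ hπ => pow_four_eq_one_realisedTuples_of_intermediate (e := e) he_sign h2 m₀ h8 hF iF jF hj hπ) h3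
    (fun b b' => transitive_realisedTuples (e := e) he_sign m b b') a a'

include he_sign in
/-- **OUT OF AN OCTIC FIELD WITH AN INTERMEDIATE QUARTIC CM FIELD INTO A `2`-TRANSITIVE OCTIC SLOT: STABILISER-TRANSITIVITY FOR FREE.**
[cite: Shimura1998, §18.2 Lemma (i)] [cite: DixonMortimer1996, §1.5, §1.6 Thm. 1.6A] [cite: Wielandt1964, §9–§10] -/
theorem stabTransitive_realisedTuples_of_intermediate_into_four (h2 : Module.finrank ℚ (Kf i₀) = 2) (m₀ m : Fin r) (h8 : Module.finrank ℚ (Kf (is m₀)) = 8)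
    {F : Type} [Field F] [NumberField F] (hF : Module.finrank ℚ F = 4) (iF : Kf i₀ →+* F) (jF : F →+* Kf (is m₀)) (hj : jF.comp iF = im m₀)
    (h4 : n m = 4) (h2t : ∀ a b a' b' : Fin (n m), a ≠ b → a' ≠ b' → ∃ π ∈ realisedTuples e τ, π m a = a' ∧ π m b = b') (a a' : Fin (n m)) :
    ∃ ν ∈ realisedTuples e τ, ν m₀ = 1 ∧ ν m a = a' :=
  stabTransitive_of_blocks_into_four (fun _ hπ _ hπ' => mul_mem_realisedTuples e τ hπ hπ') (fun _ hπ => inv_mem_realisedTuples hπ)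
    (realisedTuples_nonempty (e := e) he_sign) (fun _ hπ => pow_four_eq_one_realisedTuples_of_intermediate (e := e) he_sign h2 m₀ h8 hF iF jF hj hπ) h4 h2t a a'

end Realised

end Summit.HodgeConjecture.CorCM.MultiFieldWeil

end
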